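import Summits.BirchSwinnertonDyer.BirchSwinnertonDyer.Theorems.SignedLowerHalvesSmallImageLowerHalfBothSignsRttD2SpecialisationHKEq
import Summits.BirchSwinnertonDyer.BirchSwinnertonDyer.Theorems.SignedLowerHalvesSmallImageLowerHalfBothSignsRttCharRoadE2JunctionAssembly
import Summits.BirchSwinnertonDyer.BirchSwinnertonDyer.Theorems.SignedLowerHalvesSmallImageLowerHalfBothSignsRttCharRoadE2OfLocalisation
import HarnessLib

/-!
# Route `SignedLowerHalves`, crux L `SmallImageLowerHalfBothSigns` (stmt-BirchSwinnertonDyer-23599), line `rtt_w3` v13 — E2, rows (6′)+(6′d), LEAD: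
# THE GLUE'S `hK` FROM ROAD D THROUGH THE JUNCTION — `λ(H ⧸ Λ_𝒪∙j(sp¹ ζ̄)) ≤ λ(Y)` from `Thm52Shape`, `hdef`, `sp¹`, `j`, `coker sp¹ ↪ H²₂[f]`, `λ(Ysp) ≤ λ(Y)`

WHY (BRIEF-E2 rev 3.2 §2, `Lines/rtt_w3-BRIEF-E2-g9c.md`; LEAD g10). This file COMPOSES, by name, road D in equality form (LEAD
`SmallImageRttD2LamSpec.lambdaInvariant_quotSMulTop_add_torsionBy_eq_of_thm52Shape_of_torsionBy_eq_bot`) with the junction assembly (LEAD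
`SmallImageRttCharRoad.lambdaInvariant_quotient_span_le_of_junction`) in -w3 g19's road-D coordinates (`R = 𝒪⟦T₂⟧⟦T₁⟧`, `f = C (X − C b)`, `φ`, `ι`,
`Hsp = QuotSMulTop f H1` with its pinned `Λ_𝒪`-structure, cyclic specialised zeta module `Z̄ = R∙ζ̄`): the output is the binder `hK` of
`charRoad_E2_of_localisation` for `H := ker gX` and any `Y` with `λ(H²₂/f) ≤ λ(Y)` (in E2 `Y := coker gX`). HYPOTHESES = the Galois side of the junction:
`sp¹ : Hsp → B` (`B = 𝐇¹_Σ(K^cyc_∞, T*)`) with `λ(B ⧸ sp¹(Hsp)) ≤ λ(H²₂[f])`, `j : B ↠ H` (Poitou–Tate), `hdef`, `λ(Ysp) ≤ λ(Y)` — rows J1–J4 of BRIEF-E2 rev 4.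
* `lambdaInvariant_quotient_span_singleton_eq_quotSMulTop_quotient` — `λ(Hsp ⧸ Λ_𝒪∙ζ̄) = λ(QuotSMulTop f (H1 ⧸ D.Z))` (g19's swap p776060 + `Λ_𝒪∙ζ̄ = R∙ζ̄`, in `λ`);
* ★★★ `lambdaInvariant_quotient_span_le_of_roadD_junction` — the composition (the glue's `hK`);
* ★★★★ `charRoad_E2_of_roadD_junction` — the E2 glue `charRoad_E2_of_localisation` with `hK` DISCHARGED by the above: `hmeet` and the f.g.-torsion of
  `ker gX ⧸ Λ_𝒪∙z` are derived from `Col` and `z ≠ 0` (⟸ (an)); remaining hypotheses = J1–J4, `z`/`hz`, `hdef`, `Col`, `hCol`, the unit `𝔞`;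
  `charRoad_E2_of_roadD_junction_exact` — the same with J3 in exactness form `j₀ : B → Q`, `Function.Exact j₀ gX`, `j₀ (s ζ̄) = z`.
THEOREMS ONLY (`--supports stmt-BirchSwinnertonDyer-23599` helper); closes nothing; crux L, crux M, E2 and BSD remain OPEN and are proved for NO curve by any of this.
[cite: JohnsonLeungKings2011, Thm. 5.2, Cor. 5.3, Lemma 4.4] [cite: Kobayashi2003, Thm. 7.3 i)] [cite: Washington1997, §13.2]
-/

set_option autoImplicit false
-- the Theorems namespace of this sub repeats the summit name by design (D-0017 nested layout)
set_option linter.dupNamespace false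

noncomputable section
open scoped Pointwise Classical MatrixGroups ModularForm

open PowerSeries Literature.NumberTheory.Automorphic Literature.NumberTheory.EllipticCurves Literature.NumberTheory.EllipticCurves.Module
open Literature.NumberTheory.ComplexMultiplication.EllipticUnits.JohnsonLeungKings2011
open Summit.BirchSwinnertonDyer.BirchSwinnertonDyer.Theorems.SignedBaseChangeAcDivSpecialization.LocalLength (isPrincipal_charIdeal_of_ufm)
open Summit.BirchSwinnertonDyer.BirchSwinnertonDyer.Theorems.SmallImageRttD2LamSpec
open Literature.NumberTheory.IwasawaTheory Literature.NumberTheory.EllipticCurves.GreenbergVatsal2000 CongruenceSubgroup NumberField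
  IsDedekindDomain Rat.HeightOneSpectrum Literature.NumberTheory.EllipticCurves.ModularForms

namespace Summit.BirchSwinnertonDyer.BirchSwinnertonDyer.Theorems.SmallImageRttCharRoad

universe v w w'

variable (p : ℕ) [Fact p.Prime] (S : Set (PadicAlgCl p)) [FiniteDimensional ℚ_[p] (padicCoeffField S)]
  (b : padicCoeffIntegers S) (φ : PowerSeries (IwasawaAlgebraO S) →+* IwasawaAlgebraO S)
  (hφf : φ (C (X - C b)) = 0) (hC : ∀ a : padicCoeffIntegers S, φ (C (C a)) = C a) (hX : φ X = X)
  (hker : RingHom.ker φ = Ideal.span {C (X - C b)})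

include hφf hC hX hker in
/-- **`λ(Hsp ⧸ Λ_𝒪∙z) = λ((H1 ⧸ Z)/f)`, and `Hsp ⧸ Λ_𝒪∙z` is finitely generated torsion over `Λ`.** Setting of -w3 g19's
`SmallImageRttD2LamSpec.lambdaInvariant_quotient_span_singleton_le_of_thm52Shape`: `Hsp = QuotSMulTop f H1` with a `Λ_𝒪`-structure pinned by `l • x = (ι l) • x`,
the glue's `[Algebra Λ Λ_𝒪]` (`halg`), `[Module Λ Hsp]`, `[IsScalarTower Λ Λ_𝒪 Hsp]`; `Z ≤ H1` any submodule with `Z.map mk = R∙z` (cyclic image) and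
`H1 ⧸ Z` killed by some `t ≠ 0` with `char(H1 ⧸ Z) = (g)`, `φ g ≠ 0`. Then, for the `Λ`-structure on `QuotSMulTop f (H1 ⧸ Z)` along `ι ∘ iwasawaToIwasawaO S`:
`λ(Hsp ⧸ Λ_𝒪∙z) = λ(QuotSMulTop f (H1 ⧸ Z))`, and `Hsp ⧸ Λ_𝒪∙z` is finitely generated and torsion over `Λ` (swap p776060, `Λ_𝒪∙z = R∙z`, transfer `Λ_𝒪 → Λ`).
[cite: JohnsonLeungKings2011, Lemma 4.4] [cite: Washington1997, §13.2] [folklore] -/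
theorem lambdaInvariant_quotient_span_singleton_eq_quotSMulTop_quotient {H1 : Type v} [AddCommGroup H1]
    [Module (PowerSeries (IwasawaAlgebraO S)) H1] [Module.Finite (PowerSeries (IwasawaAlgebraO S)) H1]
    (Z : Submodule (PowerSeries (IwasawaAlgebraO S)) H1) {t : PowerSeries (IwasawaAlgebraO S)} (ht0 : t ≠ 0) (ht : ∀ m : H1 ⧸ Z, t • m = 0)
    {g : PowerSeries (IwasawaAlgebraO S)} (hg : charIdeal (PowerSeries (IwasawaAlgebraO S)) (H1 ⧸ Z) = Ideal.span {g}) (hg0 : φ g ≠ 0)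
    [Module (IwasawaAlgebraO S) (QuotSMulTop (C (X - C b) : PowerSeries (IwasawaAlgebraO S)) H1)]
    (hιH : ∀ (l : IwasawaAlgebraO S) (x : QuotSMulTop (C (X - C b) : PowerSeries (IwasawaAlgebraO S)) H1),
      l • x = (PowerSeries.map (PowerSeries.C : padicCoeffIntegers S →+* IwasawaAlgebraO S) l) • x)
    [Algebra (IwasawaAlgebra p) (IwasawaAlgebraO S)]
    (halg : ∀ r : IwasawaAlgebra p, algebraMap (IwasawaAlgebra p) (IwasawaAlgebraO S) r = iwasawaToIwasawaO S r)
    [Module (IwasawaAlgebra p) (QuotSMulTop (C (X - C b) : PowerSeries (IwasawaAlgebraO S)) H1)]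
    [IsScalarTower (IwasawaAlgebra p) (IwasawaAlgebraO S) (QuotSMulTop (C (X - C b) : PowerSeries (IwasawaAlgebraO S)) H1)]
    (z : QuotSMulTop (C (X - C b) : PowerSeries (IwasawaAlgebraO S)) H1)
    (hz : Z.map ((C (X - C b) : PowerSeries (IwasawaAlgebraO S)) • (⊤ : Submodule (PowerSeries (IwasawaAlgebraO S)) H1)).mkQ =
      Submodule.span (PowerSeries (IwasawaAlgebraO S)) {z}) :
    letI : Module (IwasawaAlgebra p) (QuotSMulTop (C (X - C b) : PowerSeries (IwasawaAlgebraO S)) (H1 ⧸ Z)) :=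
      Module.compHom _ ((PowerSeries.map (PowerSeries.C : padicCoeffIntegers S →+* IwasawaAlgebraO S)).comp (iwasawaToIwasawaO S))
    lambdaInvariant p (QuotSMulTop (C (X - C b) : PowerSeries (IwasawaAlgebraO S)) H1 ⧸ Submodule.span (IwasawaAlgebraO S) {z}) =
        lambdaInvariant p (QuotSMulTop (C (X - C b) : PowerSeries (IwasawaAlgebraO S)) (H1 ⧸ Z)) ∧
      Module.Finite (IwasawaAlgebra p) (QuotSMulTop (C (X - C b) : PowerSeries (IwasawaAlgebraO S)) H1 ⧸ Submodule.span (IwasawaAlgebraO S) {z}) ∧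
      Module.IsTorsion (IwasawaAlgebra p) (QuotSMulTop (C (X - C b) : PowerSeries (IwasawaAlgebraO S)) H1 ⧸ Submodule.span (IwasawaAlgebraO S) {z}) := by
  haveI : IsDiscreteValuationRing (padicCoeffIntegers S) := by
    rw [padicCoeffIntegers_eq_unitBall S]; exact LambdaLowerBoundO.isDiscreteValuationRing_unitBall p _
  -- `Λ_𝒪 → R` the outer embedding `ι`; towers
  letI algι : Algebra (IwasawaAlgebraO S) (PowerSeries (IwasawaAlgebraO S)) :=
    (PowerSeries.map (PowerSeries.C : padicCoeffIntegers S →+* IwasawaAlgebraO S)).toAlgebra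
  haveI : IsScalarTower (IwasawaAlgebraO S) (PowerSeries (IwasawaAlgebraO S))
      (QuotSMulTop (C (X - C b) : PowerSeries (IwasawaAlgebraO S)) H1) :=
    IsScalarTower.of_algebraMap_smul fun l x ↦ (hιH l x).symm
  letI i1 : Module (IwasawaAlgebraO S) (H1 ⧸ Z) :=
    Module.compHom (H1 ⧸ Z) (PowerSeries.map (PowerSeries.C : padicCoeffIntegers S →+* IwasawaAlgebraO S))
  haveI : IsScalarTower (IwasawaAlgebraO S) (PowerSeries (IwasawaAlgebraO S)) (H1 ⧸ Z) := IsScalarTower.of_algebraMap_smul fun _ _ ↦ rfl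
  letI iΛ : Module (IwasawaAlgebra p) (QuotSMulTop (C (X - C b) : PowerSeries (IwasawaAlgebraO S)) (H1 ⧸ Z)) :=
    Module.compHom _ ((PowerSeries.map (PowerSeries.C : padicCoeffIntegers S →+* IwasawaAlgebraO S)).comp (iwasawaToIwasawaO S))
  haveI : IsScalarTower (IwasawaAlgebra p) (IwasawaAlgebraO S) (QuotSMulTop (C (X - C b) : PowerSeries (IwasawaAlgebraO S)) (H1 ⧸ Z)) :=
    IsScalarTower.of_algebraMap_smul fun r x ↦ by
      rw [halg]
      exact IsScalarTower.algebraMap_smul (PowerSeries (IwasawaAlgebraO S)) (iwasawaToIwasawaO S r) x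
  -- `Λ_𝒪∙z = R∙z`, then `Hsp ⧸ Λ_𝒪∙z ≃ₗ[Λ_𝒪] QuotSMulTop f (H1 ⧸ Z)` (g19's construction)
  have hspan := span_singleton_eq_restrictScalars_span_singleton b φ hC hX hker H1 hιH z
  obtain ⟨e60⟩ := SmallImageRttD2Descent.nonempty_quotSMulTop_quotient_linearEquiv_quotient_map
    (C (X - C b) : PowerSeries (IwasawaAlgebraO S)) Z
  let E : (QuotSMulTop (C (X - C b) : PowerSeries (IwasawaAlgebraO S)) H1 ⧸ Submodule.span (IwasawaAlgebraO S) {z}) ≃ₗ[IwasawaAlgebraO S]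
      QuotSMulTop (C (X - C b) : PowerSeries (IwasawaAlgebraO S)) (H1 ⧸ Z) :=
    (Submodule.quotEquivOfEq _ _ hspan).trans
      ((Submodule.Quotient.restrictScalarsEquiv (IwasawaAlgebraO S) (Submodule.span (PowerSeries (IwasawaAlgebraO S)) {z})).trans
        (((Submodule.quotEquivOfEq _ _ hz.symm).trans e60.symm).restrictScalars (IwasawaAlgebraO S)))
  have hE : ∀ (r : IwasawaAlgebra p) (x : QuotSMulTop (C (X - C b) : PowerSeries (IwasawaAlgebraO S)) H1 ⧸
      Submodule.span (IwasawaAlgebraO S) {z}), E (r • x) = r • E x := fun r x ↦ by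
    rw [← IsScalarTower.algebraMap_smul (IwasawaAlgebraO S) r x, map_smul, IsScalarTower.algebraMap_smul]
  let EΛ : (QuotSMulTop (C (X - C b) : PowerSeries (IwasawaAlgebraO S)) H1 ⧸ Submodule.span (IwasawaAlgebraO S) {z}) ≃ₗ[IwasawaAlgebra p]
      QuotSMulTop (C (X - C b) : PowerSeries (IwasawaAlgebraO S)) (H1 ⧸ Z) :=
    { E.toAddEquiv with map_smul' := fun r x ↦ hE r x }
  -- f.g. torsion over `Λ_𝒪`, hence over `Λ`, of `QuotSMulTop f (H1 ⧸ Z)`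
  obtain ⟨hfin, htor, -, -⟩ := finite_isTorsion_quotSMulTop_torsionBy_of_innerEval b φ hφf hC hX hker (H1 ⧸ Z) ht0 ht hg hg0
  haveI : Module.Finite (IwasawaAlgebra p) (QuotSMulTop (C (X - C b) : PowerSeries (IwasawaAlgebraO S)) (H1 ⧸ Z)) :=
    moduleFinite_of_moduleFinite_iwasawaAlgebraO p S halg _
  have htorΛ : Module.IsTorsion (IwasawaAlgebra p) (QuotSMulTop (C (X - C b) : PowerSeries (IwasawaAlgebraO S)) (H1 ⧸ Z)) :=
    isTorsion_of_isTorsion_iwasawaAlgebraO p S halg _ htor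
  exact ⟨lambdaInvariant_eq_of_linearEquiv EΛ, Module.Finite.equiv EΛ.symm, isTorsion_of_linearEquiv EΛ.symm htorΛ⟩

include hφf hC hX hker in
/-- ★★★ **The glue's `hK` from road D through the junction.** Data: -w3 g19's road-D frame (`R = 𝒪⟦T₂⟧⟦T₁⟧`, `f = C (X − C b)`, `φ`, a `ZetaSkeleton` `D` over `R`
with `H1`, `H2` finitely generated, `D.Thm52Shape`, `f`-regularity `¬ char_R(H2) ≤ (f)`, the defect hypothesis `torsionBy R (H1 ⧸ D.Z) f = ⊥`,
`Hsp = QuotSMulTop f H1` with its pinned `Λ_𝒪`-structure and scalar-tower `Λ`-structure, pinned `Λ`-structures on `H2[f]` and `Ysp = H2/f`, the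
specialised zeta module cyclic on `ζ̄`: `(D.Z).map mk = R∙ζ̄`); junction data: `Λ_𝒪`-modules `B`, `H` with scalar-tower `Λ`-structures, `s : Hsp → B`
`Λ_𝒪`-linear with `λ(B ⧸ range s) ≤ λ(H2[f])` and `B ⧸ range s` f.g. torsion over `Λ` (in E2: `sp¹`, `coker sp¹ ↪ H²₂[f]`), `j : B → H` `Λ_𝒪`-linear
surjective (in E2: `π ∘ loc_v`; NO hypothesis on `ker j = 𝐒`), `z := j (s ζ̄)` with `l • z = 0 ⇒ l • ζ̄ = 0` and `H ⧸ Λ_𝒪∙z` f.g. torsion; and a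
`Λ`-module `Y` with `λ(H2/f) ≤ λ(Y)` (in E2: `coker gX`). Then `λ(H ⧸ Λ_𝒪∙z) ≤ λ(Y)` — the binder `hK` of `charRoad_E2_of_localisation` (`H := ker gX`).
[cite: JohnsonLeungKings2011, Thm. 5.2, Cor. 5.3, Lemma 4.4] [cite: Kobayashi2003, Thm. 7.3 i)] [cite: Washington1997, §13.2] -/
theorem lambdaInvariant_quotient_span_le_of_roadD_junction {Aidx H0 H1 H2 : Type v} [AddCommGroup H0]
    [Module (PowerSeries (IwasawaAlgebraO S)) H0] [AddCommGroup H1] [Module (PowerSeries (IwasawaAlgebraO S)) H1] [AddCommGroup H2]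
    [Module (PowerSeries (IwasawaAlgebraO S)) H2] [Module.Finite (PowerSeries (IwasawaAlgebraO S)) H1]
    [Module.Finite (PowerSeries (IwasawaAlgebraO S)) H2]
    (D : ZetaSkeleton (PowerSeries (IwasawaAlgebraO S)) Aidx H0 H1 H2) (h52 : D.Thm52Shape)
    (hreg : ¬ charIdeal (PowerSeries (IwasawaAlgebraO S)) H2 ≤ Ideal.span {(C (X - C b) : PowerSeries (IwasawaAlgebraO S))})
    (hdef : Submodule.torsionBy (PowerSeries (IwasawaAlgebraO S)) (H1 ⧸ D.Z) (C (X - C b)) = ⊥)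
    -- `Hsp` with the D2-seq structures
    [Module (IwasawaAlgebraO S) (QuotSMulTop (C (X - C b) : PowerSeries (IwasawaAlgebraO S)) H1)]
    (hιH : ∀ (l : IwasawaAlgebraO S) (x : QuotSMulTop (C (X - C b) : PowerSeries (IwasawaAlgebraO S)) H1),
      l • x = (PowerSeries.map (PowerSeries.C : padicCoeffIntegers S →+* IwasawaAlgebraO S) l) • x)
    [Algebra (IwasawaAlgebra p) (IwasawaAlgebraO S)]
    (halg : ∀ r : IwasawaAlgebra p, algebraMap (IwasawaAlgebra p) (IwasawaAlgebraO S) r = iwasawaToIwasawaO S r)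
    [Module (IwasawaAlgebra p) (QuotSMulTop (C (X - C b) : PowerSeries (IwasawaAlgebraO S)) H1)]
    [IsScalarTower (IwasawaAlgebra p) (IwasawaAlgebraO S) (QuotSMulTop (C (X - C b) : PowerSeries (IwasawaAlgebraO S)) H1)]
    -- pinned `Λ`-structures on `H2[f]` and `Ysp = H2/f`
    [Module (IwasawaAlgebra p) (Submodule.torsionBy (PowerSeries (IwasawaAlgebraO S)) H2 (C (X - C b)))]
    (hΛT : ∀ (r : IwasawaAlgebra p) (x : Submodule.torsionBy (PowerSeries (IwasawaAlgebraO S)) H2 (C (X - C b))),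
      r • x = (PowerSeries.map (PowerSeries.C : padicCoeffIntegers S →+* IwasawaAlgebraO S) (iwasawaToIwasawaO S r)) • x)
    [Module (IwasawaAlgebra p) (QuotSMulTop (C (X - C b) : PowerSeries (IwasawaAlgebraO S)) H2)]
    (hΛ2 : ∀ (r : IwasawaAlgebra p) (x : QuotSMulTop (C (X - C b) : PowerSeries (IwasawaAlgebraO S)) H2),
      r • x = (PowerSeries.map (PowerSeries.C : padicCoeffIntegers S →+* IwasawaAlgebraO S) (iwasawaToIwasawaO S r)) • x)
    -- the cyclic specialised zeta module
    (ζ : QuotSMulTop (C (X - C b) : PowerSeries (IwasawaAlgebraO S)) H1)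
    (hζ : (D.Z).map ((C (X - C b) : PowerSeries (IwasawaAlgebraO S)) • (⊤ : Submodule (PowerSeries (IwasawaAlgebraO S)) H1)).mkQ =
      Submodule.span (PowerSeries (IwasawaAlgebraO S)) {ζ})
    -- the junction
    {B : Type w} {H : Type w'} [AddCommGroup B] [Module (IwasawaAlgebraO S) B] [Module (IwasawaAlgebra p) B]
    [IsScalarTower (IwasawaAlgebra p) (IwasawaAlgebraO S) B]
    [AddCommGroup H] [Module (IwasawaAlgebraO S) H] [Module (IwasawaAlgebra p) H] [IsScalarTower (IwasawaAlgebra p) (IwasawaAlgebraO S) H]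
    (s : QuotSMulTop (C (X - C b) : PowerSeries (IwasawaAlgebraO S)) H1 →ₗ[IwasawaAlgebraO S] B)
    [Module.Finite (IwasawaAlgebra p) (B ⧸ LinearMap.range s)] (htB : Module.IsTorsion (IwasawaAlgebra p) (B ⧸ LinearMap.range s))
    (hcoker : lambdaInvariant p (B ⧸ LinearMap.range s) ≤ lambdaInvariant p (Submodule.torsionBy (PowerSeries (IwasawaAlgebraO S)) H2 (C (X - C b))))
    (j : B →ₗ[IwasawaAlgebraO S] H) (hj : Function.Surjective j)
    (hmeet : ∀ l : IwasawaAlgebraO S, l • j (s ζ) = 0 → l • ζ = 0)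
    [Module.Finite (IwasawaAlgebra p) (H ⧸ Submodule.span (IwasawaAlgebraO S) {j (s ζ)})]
    (ht : Module.IsTorsion (IwasawaAlgebra p) (H ⧸ Submodule.span (IwasawaAlgebraO S) {j (s ζ)}))
    {Y : Type*} [AddCommGroup Y] [Module (IwasawaAlgebra p) Y]
    (hY : lambdaInvariant p (QuotSMulTop (C (X - C b) : PowerSeries (IwasawaAlgebraO S)) H2) ≤ lambdaInvariant p Y) :
    lambdaInvariant p (H ⧸ Submodule.span (IwasawaAlgebraO S) {j (s ζ)}) ≤ lambdaInvariant p Y := by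
  haveI : UniqueFactorizationMonoid (PowerSeries (IwasawaAlgebraO S)) := by
    haveI : IsDiscreteValuationRing (padicCoeffIntegers S) := by
      rw [padicCoeffIntegers_eq_unitBall S]; exact LambdaLowerBoundO.isDiscreteValuationRing_unitBall p _
    exact Literature.NumberTheory.IwasawaTheory.uniqueFactorizationMonoid_powerSeries_powerSeries (padicCoeffIntegers S)
  -- the `Λ`-structure on `QuotSMulTop f (H1 ⧸ D.Z)` along `ι ∘ iwasawaToIwasawaO S`
  letI iΛ : Module (IwasawaAlgebra p) (QuotSMulTop (C (X - C b) : PowerSeries (IwasawaAlgebraO S)) (H1 ⧸ D.Z)) :=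
    Module.compHom _ ((PowerSeries.map (PowerSeries.C : padicCoeffIntegers S →+* IwasawaAlgebraO S)).comp (iwasawaToIwasawaO S))
  -- road D in equality form (defect-free)
  have hD := lambdaInvariant_quotSMulTop_add_torsionBy_eq_of_thm52Shape_of_torsionBy_eq_bot p S b φ hφf hC hX hker D h52 hreg hdef
    (fun _ _ ↦ rfl) hΛT hΛ2
  -- torsion witness and principal generator for `H1 ⧸ D.Z` (from `Thm52Shape`)
  obtain ⟨⟨-, -, htorsA, -⟩, hchar⟩ := h52
  obtain ⟨tA, htA, htA0⟩ := Submodule.annihilator_top_inter_nonZeroDivisors htorsA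
  have htA' : ∀ m : H1 ⧸ D.Z, tA • m = 0 := fun m ↦ Submodule.mem_annihilator.mp htA m Submodule.mem_top
  obtain ⟨g, hg⟩ := (isPrincipal_charIdeal_of_ufm (R := PowerSeries (IwasawaAlgebraO S)) (M := H2)).principal
  have hgB : charIdeal (PowerSeries (IwasawaAlgebraO S)) H2 = Ideal.span {g} := hg
  have hgA : charIdeal (PowerSeries (IwasawaAlgebraO S)) (H1 ⧸ D.Z) = Ideal.span {g} := by
    rw [show charIdeal (PowerSeries (IwasawaAlgebraO S)) (H1 ⧸ D.Z) = charIdeal (PowerSeries (IwasawaAlgebraO S)) H2 from hchar, hgB]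
  have hg0 : φ g ≠ 0 := by
    intro h0
    apply hreg
    rw [hgB, Ideal.span_singleton_le_iff_mem, ← hker]
    exact h0
  -- `λ(Hsp ⧸ Λ_𝒪∙ζ̄) = λ((H1 ⧸ Z)/f)`, f.g. torsion over `Λ`
  obtain ⟨hlam, hfin', htor'⟩ := lambdaInvariant_quotient_span_singleton_eq_quotSMulTop_quotient p S b φ hφf hC hX hker D.Z
    (nonZeroDivisors.ne_zero htA0) htA' hgA hg0 hιH halg ζ hζ
  haveI := hfin'
  -- the junction assembly
  refine lambdaInvariant_quotient_span_le_of_junction' s j hj ζ (j (s ζ)) rfl hmeet htor' ht htB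
    (lambdaInvariant p (Submodule.torsionBy (PowerSeries (IwasawaAlgebraO S)) H2 (C (X - C b)))) hcoker ?_
  rw [hlam, hD]
  exact hY

/-! ## E2 from road D + the junction + (Col) + (an): the glue `charRoad_E2_of_localisation` with its `hK` DISCHARGED by name -/

section E2

variable {p : ℕ} [Fact p.Prime] {S : Set (PadicAlgCl p)} [Algebra (IwasawaAlgebra p) (IwasawaAlgebraO S)]
set_option maxHeartbeats 400000 in -- buildfix (bf3-g31): 160k/180k FAIL, 200k PASS at accept time; line-neutral budget line
/-- ★★★★ **E2 from road D through the junction.** The E2 glue `charRoad_E2_of_localisation` (p776213) with its (K)-input `hK` REPLACED by road D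
(`Thm52Shape` = honda's FACT `cor53_thm52ShapeO` on the pinned carriers, `f`-regularity, the defect hypothesis `hdef`, the cyclic specialised zeta
module `R∙ζ̄`) and the junction (`s = sp¹ : Hsp → B`, `B ⧸ range s` f.g. torsion with `λ ≤ λ(H²₂[f])`; `j : B ↠ ker gX` with `j (s ζ̄) = z`;
`λ(H²₂/f) ≤ λ(coker gX)`): the side conditions `hmeet`, f.g.-torsion of `ker gX ⧸ Λ_𝒪∙z` are DERIVED here from `Col : Q ≃ Λ_𝒪` and `z ≠ 0` (⟸ (an)).
Output: the E2-tail's conclusion with `λ(X')` on the right (`X' := Dψ.X` with its `Λ_𝒪`-structure, p776944; -w3 g20's `charRoad_E2_of_locSat` pins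
`Q := DQ.X`, `gX := gXLinearMapO`). Remaining HYPOTHESES = rows J1–J4, (2′) `z`/`hz`, (4′) `hdef`, (5′) `Col`, (7′) `hCol`, the unit `𝔞` (`hζ`).
[cite: Kobayashi2003, Thm. 7.3 i), Thm. 1.3] [cite: JohnsonLeungKings2011, Thm. 5.2, Cor. 5.3] [cite: PollackRubin2004, §6–§7] [cite: Washington1997, §13.2] -/
theorem charRoad_E2_of_roadD_junction (hS : 0 < Module.finrank ℚ_[p] (padicCoeffField S))
    (halg : ∀ r : IwasawaAlgebra p, algebraMap (IwasawaAlgebra p) (IwasawaAlgebraO S) r = iwasawaToIwasawaO S r)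
    {M : ℕ} [NeZero M] (g : CuspForm (Gamma0 M) 2) (ι : coeffField g →+* PadicAlgCl p) (hng : IsNewform0 g)
    (S₀ : Finset (HeightOneSpectrum (𝓞 ℚ)))
    {Q X' : Type} [AddCommGroup Q] [AddCommGroup X']
    [Module (IwasawaAlgebraO S) Q] [Module (IwasawaAlgebra p) Q] [IsScalarTower (IwasawaAlgebra p) (IwasawaAlgebraO S) Q]
    [Module (IwasawaAlgebraO S) X'] [Module (IwasawaAlgebra p) X'] [IsScalarTower (IwasawaAlgebra p) (IwasawaAlgebraO S) X']
    [Module.Finite (IwasawaAlgebra p) X'] (hX' : Module.IsTorsion (IwasawaAlgebra p) X')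
    (gX : Q →ₗ[IwasawaAlgebraO S] X') (z : Q) (hz : gX z = 0)
    -- road D (g19's frame)
    (b : padicCoeffIntegers S) (φ : PowerSeries (IwasawaAlgebraO S) →+* IwasawaAlgebraO S)
    (hφf : φ (C (X - C b)) = 0) (hC : ∀ a : padicCoeffIntegers S, φ (C (C a)) = C a) (hX : φ X = X)
    (hker : RingHom.ker φ = Ideal.span {C (X - C b)})
    {Aidx H0 H1 H2 : Type v} [AddCommGroup H0]
    [Module (PowerSeries (IwasawaAlgebraO S)) H0] [AddCommGroup H1] [Module (PowerSeries (IwasawaAlgebraO S)) H1] [AddCommGroup H2]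
    [Module (PowerSeries (IwasawaAlgebraO S)) H2] [Module.Finite (PowerSeries (IwasawaAlgebraO S)) H1]
    [Module.Finite (PowerSeries (IwasawaAlgebraO S)) H2]
    (D : ZetaSkeleton (PowerSeries (IwasawaAlgebraO S)) Aidx H0 H1 H2) (h52 : D.Thm52Shape)
    (hreg : ¬ charIdeal (PowerSeries (IwasawaAlgebraO S)) H2 ≤ Ideal.span {(C (X - C b) : PowerSeries (IwasawaAlgebraO S))})
    (hdef : Submodule.torsionBy (PowerSeries (IwasawaAlgebraO S)) (H1 ⧸ D.Z) (C (X - C b)) = ⊥)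
    [Module (IwasawaAlgebraO S) (QuotSMulTop (C (X - C b) : PowerSeries (IwasawaAlgebraO S)) H1)]
    (hιH : ∀ (l : IwasawaAlgebraO S) (x : QuotSMulTop (C (X - C b) : PowerSeries (IwasawaAlgebraO S)) H1),
      l • x = (PowerSeries.map (PowerSeries.C : padicCoeffIntegers S →+* IwasawaAlgebraO S) l) • x)
    [Module (IwasawaAlgebra p) (QuotSMulTop (C (X - C b) : PowerSeries (IwasawaAlgebraO S)) H1)]
    [IsScalarTower (IwasawaAlgebra p) (IwasawaAlgebraO S) (QuotSMulTop (C (X - C b) : PowerSeries (IwasawaAlgebraO S)) H1)]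
    [Module (IwasawaAlgebra p) (Submodule.torsionBy (PowerSeries (IwasawaAlgebraO S)) H2 (C (X - C b)))]
    (hΛT : ∀ (r : IwasawaAlgebra p) (x : Submodule.torsionBy (PowerSeries (IwasawaAlgebraO S)) H2 (C (X - C b))),
      r • x = (PowerSeries.map (PowerSeries.C : padicCoeffIntegers S →+* IwasawaAlgebraO S) (iwasawaToIwasawaO S r)) • x)
    [Module (IwasawaAlgebra p) (QuotSMulTop (C (X - C b) : PowerSeries (IwasawaAlgebraO S)) H2)]
    (hΛ2 : ∀ (r : IwasawaAlgebra p) (x : QuotSMulTop (C (X - C b) : PowerSeries (IwasawaAlgebraO S)) H2),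
      r • x = (PowerSeries.map (PowerSeries.C : padicCoeffIntegers S →+* IwasawaAlgebraO S) (iwasawaToIwasawaO S r)) • x)
    (ζ : QuotSMulTop (C (X - C b) : PowerSeries (IwasawaAlgebraO S)) H1)
    (hζ : (D.Z).map ((C (X - C b) : PowerSeries (IwasawaAlgebraO S)) • (⊤ : Submodule (PowerSeries (IwasawaAlgebraO S)) H1)).mkQ =
      Submodule.span (PowerSeries (IwasawaAlgebraO S)) {ζ})
    -- the junction
    {B : Type w} [AddCommGroup B] [Module (IwasawaAlgebraO S) B] [Module (IwasawaAlgebra p) B]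
    [IsScalarTower (IwasawaAlgebra p) (IwasawaAlgebraO S) B]
    (s : QuotSMulTop (C (X - C b) : PowerSeries (IwasawaAlgebraO S)) H1 →ₗ[IwasawaAlgebraO S] B)
    [Module.Finite (IwasawaAlgebra p) (B ⧸ LinearMap.range s)] (htB : Module.IsTorsion (IwasawaAlgebra p) (B ⧸ LinearMap.range s))
    (hcoker : lambdaInvariant p (B ⧸ LinearMap.range s) ≤ lambdaInvariant p (Submodule.torsionBy (PowerSeries (IwasawaAlgebraO S)) H2 (C (X - C b))))
    (j : B →ₗ[IwasawaAlgebraO S] LinearMap.ker gX) (hj : Function.Surjective j) (hjz : j (s ζ) = ⟨z, hz⟩)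
    (hY : lambdaInvariant p (QuotSMulTop (C (X - C b) : PowerSeries (IwasawaAlgebraO S)) H2) ≤ lambdaInvariant p (X' ⧸ LinearMap.range gX))
    -- (Col) and (an)
    (Col : Q ≃ₗ[IwasawaAlgebraO S] IwasawaAlgebraO S)
    (L : IwasawaAlgebraO (Set.range ι)) (hL : L ≠ 0) {c : PadicAlgCl p} (hc : c ≠ 0)
    (fv : HeightOneSpectrum (𝓞 ℚ) → ℤ_[p])
    (hfv : ∀ v ∈ S₀, fv v ≠ 0 ∧ (fv v).valuation = (frobeniusExponent p (natGenerator v : ℤ_[p])).valuation)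
    (hCol : iwasawaOToPowerSeries S (Col z) =
      PowerSeries.C c * iwasawaOToPowerSeries (Set.range ι) L *
        ∏ v ∈ S₀, Polynomial.aeval (PowerSeries.C ((natGenerator v : PadicAlgCl p)⁻¹) *
            (PowerSeries.binomialSeries ℤ_[p] (fv v)).map (algebraMap ℤ_[p] (PadicAlgCl p)))
          (1 - Polynomial.C (embCoeff g ι (natGenerator v)) * Polynomial.X +
            (if natGenerator v ∣ M then 0 else Polynomial.C (natGenerator v : PadicAlgCl p)) * Polynomial.X ^ 2)) :
    ∃ d : ℕ, (∀ k : ℕ, ‖PowerSeries.coeff k (iwasawaOToPowerSeries (Set.range ι) L)‖ ≤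
        ‖PowerSeries.coeff d (iwasawaOToPowerSeries (Set.range ι) L)‖) ∧
      (∀ k : ℕ, k < d → ‖PowerSeries.coeff k (iwasawaOToPowerSeries (Set.range ι) L)‖ <
        ‖PowerSeries.coeff d (iwasawaOToPowerSeries (Set.range ι) L)‖) ∧
      Module.finrank ℚ_[p] (padicCoeffField S) * (d + ∑ v ∈ S₀, p ^ (frobeniusExponent p (natGenerator v : ℤ_[p])).valuation *
        layerLambda ((1 - Polynomial.C (embCoeff g ι (natGenerator v)) * Polynomial.X +
          (if natGenerator v ∣ M then 0 else Polynomial.C (natGenerator v : PadicAlgCl p)) * Polynomial.X ^ 2).comp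
            (Polynomial.C ((natGenerator v : PadicAlgCl p)⁻¹) * (Polynomial.X + 1)))) ≤ lambdaInvariant p X' := by
  haveI : FiniteDimensional ℚ_[p] (padicCoeffField S) := Module.finite_of_finrank_pos hS
  haveI : IsDiscreteValuationRing (padicCoeffIntegers S) := by
    rw [padicCoeffIntegers_eq_unitBall S]; exact LambdaLowerBoundO.isDiscreteValuationRing_unitBall p _
  -- `Q ≅ Λ_𝒪` is torsion-free and Noetherian
  haveI : NoZeroSMulDivisors (IwasawaAlgebraO S) Q := by
    refine ⟨fun {c x} h ↦ ?_⟩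
    have h' : c * Col x = 0 := by rw [← smul_eq_mul, ← map_smul, h, map_zero]
    exact (mul_eq_zero.mp h').imp_right fun hx ↦ Col.injective (by rw [hx, map_zero])
  haveI : IsNoetherian (IwasawaAlgebraO S) Q := isNoetherian_of_linearEquiv Col.symm
  -- `z ≠ 0` from (an)
  haveI : FiniteDimensional ℚ (coeffField g) := IsNewform0.finiteDimensional_coeffField_holds hng
  haveI : FiniteDimensional ℚ_[p] (padicCoeffField (Set.range ι)) := GreenbergSelmer.finiteDimensional_padicCoeffField ι
  have hz0 : z ≠ 0 := by
    obtain ⟨d, hle, hlt⟩ := SmallImageRttE2Num.exists_normLambda_iwasawaAlgebraO p (Set.range ι) L hL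
    have hL' : iwasawaOToPowerSeries (Set.range ι) L ≠ 0 :=
      (map_ne_zero_iff _ (iwasawaOToPowerSeries_injective _)).mpr hL
    have hP : ∀ v ∈ S₀, (1 - Polynomial.C (embCoeff g ι (natGenerator v)) * Polynomial.X +
        (if natGenerator v ∣ M then 0 else Polynomial.C (natGenerator v : PadicAlgCl p)) * Polynomial.X ^ 2) ≠ 0 :=
      fun v _ h0 ↦ by
        have h1 := congrArg (fun P : Polynomial (PadicAlgCl p) ↦ P.coeff 0) h0
        simp only [Polynomial.coeff_add, Polynomial.coeff_sub, Polynomial.coeff_one_zero, Polynomial.coeff_C_mul,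
          Polynomial.coeff_X_zero, mul_zero, sub_zero, Polynomial.coeff_zero] at h1
        split_ifs at h1 with hd
        · simp only [zero_mul, Polynomial.coeff_zero, add_zero, one_ne_zero] at h1
        · simp only [Polynomial.coeff_C_mul, Polynomial.coeff_X_pow, mul_ite, mul_one, mul_zero] at h1
          norm_num at h1
    have hu : ∀ v ∈ S₀, ((natGenerator v : PadicAlgCl p))⁻¹ ≠ 0 := fun v _ ↦
      inv_ne_zero (Nat.cast_ne_zero.mpr (prime_natGenerator v).ne_zero)
    have hColz : Col z ≠ 0 := ne_zero_of_eulerProduct S S₀ hc hL' hle hlt _ _ fv hP hu (fun v hv ↦ (hfv v hv).1) hCol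
    intro h0
    exact hColz (by rw [h0, map_zero])
  -- `hmeet`: `l • z = 0 ⇒ l = 0`
  have hmeet : ∀ l : IwasawaAlgebraO S, l • j (s ζ) = 0 → l • ζ = 0 := fun l hl ↦ by
    rw [hjz] at hl
    have hl' : l • z = 0 := by simpa using congrArg Subtype.val hl
    rcases eq_zero_or_eq_zero_of_smul_eq_zero hl' with h | h
    · rw [h, zero_smul]
    · exact absurd h hz0
  -- `ker gX ⧸ Λ_𝒪∙z` is finitely generated torsion over `Λ` (`a := Col z ≠ 0` kills it)
  haveI : Module.Finite (IwasawaAlgebra p) (LinearMap.ker gX ⧸ Submodule.span (IwasawaAlgebraO S) {j (s ζ)}) :=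
    moduleFinite_of_moduleFinite_iwasawaAlgebraO p S halg _
  have htO : Module.IsTorsion (IwasawaAlgebraO S) (LinearMap.ker gX ⧸ Submodule.span (IwasawaAlgebraO S) {j (s ζ)}) := by
    intro x
    refine ⟨⟨Col z, mem_nonZeroDivisors_of_ne_zero fun h ↦ hz0 (Col.injective (by rw [h, map_zero]))⟩, ?_⟩
    obtain ⟨y, rfl⟩ := Submodule.Quotient.mk_surjective _ x
    rw [Submonoid.mk_smul, ← Submodule.Quotient.mk_smul, Submodule.Quotient.mk_eq_zero, Submodule.mem_span_singleton, hjz]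
    refine ⟨Col (y : Q), Subtype.ext ?_⟩
    change Col (y : Q) • z = Col z • (y : Q)
    apply Col.injective
    rw [map_smul, map_smul, smul_eq_mul, smul_eq_mul, mul_comm]
  have ht : Module.IsTorsion (IwasawaAlgebra p) (LinearMap.ker gX ⧸ Submodule.span (IwasawaAlgebraO S) {j (s ζ)}) :=
    isTorsion_of_isTorsion_iwasawaAlgebraO p S halg _ htO
  -- the glue's `hK` by name, then the glue
  have hK := lambdaInvariant_quotient_span_le_of_roadD_junction p S b φ hφf hC hX hker D h52 hreg hdef hιH halg hΛT hΛ2 ζ hζ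
    s htB hcoker j hj hmeet ht hY
  rw [hjz] at hK
  exact charRoad_E2_of_localisation hS halg g ι hng S₀ hX' gX z hz hK Col L hL hc fv hfv hCol

/-- ★★★★ **E2 from road D through the junction — exactness form of J3**: as `charRoad_E2_of_roadD_junction` with `j₀ : B → Q` `Λ_𝒪`-linear,
`Function.Exact j₀ gX` (Poitou–Tate) and `j₀ (s ζ̄) = z`. [cite: Kobayashi2003, Thm. 7.3 i)] [cite: JohnsonLeungKings2011, Cor. 5.3] [cite: Washington1997, §13.2] -/
theorem charRoad_E2_of_roadD_junction_exact (hS : 0 < Module.finrank ℚ_[p] (padicCoeffField S))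
    (halg : ∀ r : IwasawaAlgebra p, algebraMap (IwasawaAlgebra p) (IwasawaAlgebraO S) r = iwasawaToIwasawaO S r)
    {M : ℕ} [NeZero M] (g : CuspForm (Gamma0 M) 2) (ι : coeffField g →+* PadicAlgCl p) (hng : IsNewform0 g)
    (S₀ : Finset (HeightOneSpectrum (𝓞 ℚ)))
    {Q X' : Type} [AddCommGroup Q] [AddCommGroup X'] [Module (IwasawaAlgebraO S) Q] [Module (IwasawaAlgebra p) Q]
    [IsScalarTower (IwasawaAlgebra p) (IwasawaAlgebraO S) Q] [Module (IwasawaAlgebraO S) X'] [Module (IwasawaAlgebra p) X']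
    [IsScalarTower (IwasawaAlgebra p) (IwasawaAlgebraO S) X'] [Module.Finite (IwasawaAlgebra p) X'] (hX' : Module.IsTorsion (IwasawaAlgebra p) X')
    (gX : Q →ₗ[IwasawaAlgebraO S] X') (z : Q) (hz : gX z = 0) (b : padicCoeffIntegers S) (φ : PowerSeries (IwasawaAlgebraO S) →+* IwasawaAlgebraO S)
    (hφf : φ (C (X - C b)) = 0) (hC : ∀ a : padicCoeffIntegers S, φ (C (C a)) = C a) (hX : φ X = X)
    (hker : RingHom.ker φ = Ideal.span {C (X - C b)})
    {Aidx H0 H1 H2 : Type v} [AddCommGroup H0]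
    [Module (PowerSeries (IwasawaAlgebraO S)) H0] [AddCommGroup H1] [Module (PowerSeries (IwasawaAlgebraO S)) H1] [AddCommGroup H2]
    [Module (PowerSeries (IwasawaAlgebraO S)) H2] [Module.Finite (PowerSeries (IwasawaAlgebraO S)) H1]
    [Module.Finite (PowerSeries (IwasawaAlgebraO S)) H2]
    (D : ZetaSkeleton (PowerSeries (IwasawaAlgebraO S)) Aidx H0 H1 H2) (h52 : D.Thm52Shape)
    (hreg : ¬ charIdeal (PowerSeries (IwasawaAlgebraO S)) H2 ≤ Ideal.span {(C (X - C b) : PowerSeries (IwasawaAlgebraO S))})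
    (hdef : Submodule.torsionBy (PowerSeries (IwasawaAlgebraO S)) (H1 ⧸ D.Z) (C (X - C b)) = ⊥)
    [Module (IwasawaAlgebraO S) (QuotSMulTop (C (X - C b) : PowerSeries (IwasawaAlgebraO S)) H1)]
    (hιH : ∀ (l : IwasawaAlgebraO S) (x : QuotSMulTop (C (X - C b) : PowerSeries (IwasawaAlgebraO S)) H1),
      l • x = (PowerSeries.map (PowerSeries.C : padicCoeffIntegers S →+* IwasawaAlgebraO S) l) • x)
    [Module (IwasawaAlgebra p) (QuotSMulTop (C (X - C b) : PowerSeries (IwasawaAlgebraO S)) H1)]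
    [IsScalarTower (IwasawaAlgebra p) (IwasawaAlgebraO S) (QuotSMulTop (C (X - C b) : PowerSeries (IwasawaAlgebraO S)) H1)]
    [Module (IwasawaAlgebra p) (Submodule.torsionBy (PowerSeries (IwasawaAlgebraO S)) H2 (C (X - C b)))]
    (hΛT : ∀ (r : IwasawaAlgebra p) (x : Submodule.torsionBy (PowerSeries (IwasawaAlgebraO S)) H2 (C (X - C b))),
      r • x = (PowerSeries.map (PowerSeries.C : padicCoeffIntegers S →+* IwasawaAlgebraO S) (iwasawaToIwasawaO S r)) • x)
    [Module (IwasawaAlgebra p) (QuotSMulTop (C (X - C b) : PowerSeries (IwasawaAlgebraO S)) H2)]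
    (hΛ2 : ∀ (r : IwasawaAlgebra p) (x : QuotSMulTop (C (X - C b) : PowerSeries (IwasawaAlgebraO S)) H2),
      r • x = (PowerSeries.map (PowerSeries.C : padicCoeffIntegers S →+* IwasawaAlgebraO S) (iwasawaToIwasawaO S r)) • x)
    (ζ : QuotSMulTop (C (X - C b) : PowerSeries (IwasawaAlgebraO S)) H1) (hζ : (D.Z).map ((C (X - C b) : PowerSeries (IwasawaAlgebraO S)) • (⊤ : Submodule (PowerSeries (IwasawaAlgebraO S)) H1)).mkQ =
      Submodule.span (PowerSeries (IwasawaAlgebraO S)) {ζ})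
    {B : Type w} [AddCommGroup B] [Module (IwasawaAlgebraO S) B] [Module (IwasawaAlgebra p) B] [IsScalarTower (IwasawaAlgebra p) (IwasawaAlgebraO S) B]
    (s : QuotSMulTop (C (X - C b) : PowerSeries (IwasawaAlgebraO S)) H1 →ₗ[IwasawaAlgebraO S] B)
    [Module.Finite (IwasawaAlgebra p) (B ⧸ LinearMap.range s)] (htB : Module.IsTorsion (IwasawaAlgebra p) (B ⧸ LinearMap.range s))
    (hcoker : lambdaInvariant p (B ⧸ LinearMap.range s) ≤ lambdaInvariant p (Submodule.torsionBy (PowerSeries (IwasawaAlgebraO S)) H2 (C (X - C b))))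
    (j₀ : B →ₗ[IwasawaAlgebraO S] Q) (hexact : Function.Exact j₀ gX) (hjz : j₀ (s ζ) = z)
    (hY : lambdaInvariant p (QuotSMulTop (C (X - C b) : PowerSeries (IwasawaAlgebraO S)) H2) ≤ lambdaInvariant p (X' ⧸ LinearMap.range gX))
    (Col : Q ≃ₗ[IwasawaAlgebraO S] IwasawaAlgebraO S) (L : IwasawaAlgebraO (Set.range ι)) (hL : L ≠ 0) {c : PadicAlgCl p} (hc : c ≠ 0)
    (fv : HeightOneSpectrum (𝓞 ℚ) → ℤ_[p]) (hfv : ∀ v ∈ S₀, fv v ≠ 0 ∧ (fv v).valuation = (frobeniusExponent p (natGenerator v : ℤ_[p])).valuation)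
    (hCol : iwasawaOToPowerSeries S (Col z) =
      PowerSeries.C c * iwasawaOToPowerSeries (Set.range ι) L *
        ∏ v ∈ S₀, Polynomial.aeval (PowerSeries.C ((natGenerator v : PadicAlgCl p)⁻¹) *
            (PowerSeries.binomialSeries ℤ_[p] (fv v)).map (algebraMap ℤ_[p] (PadicAlgCl p)))
          (1 - Polynomial.C (embCoeff g ι (natGenerator v)) * Polynomial.X +
            (if natGenerator v ∣ M then 0 else Polynomial.C (natGenerator v : PadicAlgCl p)) * Polynomial.X ^ 2)) :
    ∃ d : ℕ, (∀ k : ℕ, ‖PowerSeries.coeff k (iwasawaOToPowerSeries (Set.range ι) L)‖ ≤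
        ‖PowerSeries.coeff d (iwasawaOToPowerSeries (Set.range ι) L)‖) ∧
      (∀ k : ℕ, k < d → ‖PowerSeries.coeff k (iwasawaOToPowerSeries (Set.range ι) L)‖ <
        ‖PowerSeries.coeff d (iwasawaOToPowerSeries (Set.range ι) L)‖) ∧
      Module.finrank ℚ_[p] (padicCoeffField S) * (d + ∑ v ∈ S₀, p ^ (frobeniusExponent p (natGenerator v : ℤ_[p])).valuation *
        layerLambda ((1 - Polynomial.C (embCoeff g ι (natGenerator v)) * Polynomial.X +
          (if natGenerator v ∣ M then 0 else Polynomial.C (natGenerator v : PadicAlgCl p)) * Polynomial.X ^ 2).comp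
            (Polynomial.C ((natGenerator v : PadicAlgCl p)⁻¹) * (Polynomial.X + 1)))) ≤ lambdaInvariant p X' := by
  -- `j := j₀` co-restricted to `ker gX`, surjective by exactness
  have hmem : ∀ x : B, j₀ x ∈ LinearMap.ker gX := fun x ↦ by
    rw [LinearMap.mem_ker]
    exact hexact.apply_apply_eq_zero x
  let j : B →ₗ[IwasawaAlgebraO S] LinearMap.ker gX := LinearMap.codRestrict (LinearMap.ker gX) j₀ hmem
  have hj : Function.Surjective j := by
    rintro ⟨y, hy⟩
    obtain ⟨x, rfl⟩ := (hexact y).mp (LinearMap.mem_ker.mp hy)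
    exact ⟨x, rfl⟩
  exact charRoad_E2_of_roadD_junction hS halg g ι hng S₀ hX' gX z hz b φ hφf hC hX hker D h52 hreg hdef hιH hΛT hΛ2 ζ hζ s htB hcoker j hj
    (Subtype.ext hjz) hY Col L hL hc fv hfv hCol

end E2

end Summit.BirchSwinnertonDyer.BirchSwinnertonDyer.Theorems.SmallImageRttCharRoad

end
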